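import Summits.ValiantsHypothesis.ValiantsHypothesis.Theorems.BarrierLeverPartitionMinorsHitByVPRoabpNfa

/-!
# Route BarrierLever — item `PartitionMinorsHitByVP` (stmt-ValiantsHypothesis-19717):
# SEQUENTIAL-TRANSDUCER LAYOUTS are hit by the ROABP door (first class theorems of the NFA sub-door)

Helper file (`--supports stmt-ValiantsHypothesis-19717`; cell valiant-natproofs, rung V4, 𝒟-side; prover seat val-np-p7 g15,
sub-target (d) of the round-3 owner table, MEMO-ttdoor-g16 §§10–11b «transducer layouts»). Closes NO item.

A deterministic finite-state TRANSDUCER reads the `x`-coordinates in an order `σ` and, at round `k`, writes the `y`-coordinate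
`τ k` (state set `Q ↪ Fin s`, step-dependent transition `δ k` and output `out k`). On the alternating interleaving
`x_{σ 0} y_{τ 0} x_{σ 1} y_{τ 1} …` (`exists_interleaving`) the width-`2s` automaton «transducer state × pending output bit»
has EXACTLY ONE run with nonzero weights on the word of `(A, B)` when `B` is the transducer image of `A`, and none otherwise
(`transducer_run_iff`). Hence (`partitionMinor_hit_of_transducer`): if the columns of an injective layout are the transducer
images of its rows (up to a row bijection `ψ`), the run-count matrix on `U × W` is the permutation matrix of `ψ` and the layout —
of ANY size `r ≤ 2^h`, i.e. in the regime where the door has content — is hit inside `SmallCircuits ℂ (2h) (3c+3)` whenever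
`2s ≤ (2h)^c`, `h ≥ 2`. The transducer map need only be injective ON THE ROWS (automatic from `w` injective), not a bijection
of the cube. First classes (cube automorphisms, relabellings, Gray-code, binary-successor, negation, prefix-parity and
sliding-window layouts): `…RoabpTransducerClasses.lean`.

STATUS OF THE DOOR: its conjecture of record `ROABPHitsPartitionMinors` is REFUTED (`RoabpDoor.not_ROABPHitsPartitionMinors`,
`…RoabpDoorNegative.lean`: thin rows × binary-code columns, one-cut sub-block rank bound; planner p1 g17) — so these are
CERTIFIED-CLASS theorems of a door that cannot carry item 19717, nothing more.
WHAT THIS IS NOT: transparent (permutation-matrix) certificates only; nothing on crux 14610 or on VP ≠ VNP.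
-/

namespace Summit.ValiantsHypothesis.Theorems.BarrierLever.RoabpDoor

open Matrix Finset Literature.Computability.AlgebraicComplexity

/-- The `x`-variable `castAdd h a` occurs in `x^A y^B` iff `a ∈ A`. -/
@[simp] theorem castAdd_mem_monoVars (h : ℕ) (A B : Finset (Fin h)) (a : Fin h) :
    Fin.castAdd h a ∈ monoVars h A B ↔ a ∈ A := by
  classical
  unfold monoVars
  rw [Finset.mem_union, Finset.mem_image, Finset.mem_image]
  constructor
  · rintro (⟨a', ha', he⟩ | ⟨c, _, he⟩)
    · rwa [← Fin.castAdd_injective _ _ he]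
    · exfalso
      have := congrArg Fin.val he
      simp at this
      omega
  · intro ha; exact Or.inl ⟨a, ha, rfl⟩

/-- The `y`-variable `natAdd h c` occurs in `x^A y^B` iff `c ∈ B`. -/
@[simp] theorem natAdd_mem_monoVars (h : ℕ) (A B : Finset (Fin h)) (c : Fin h) :
    Fin.natAdd h c ∈ monoVars h A B ↔ c ∈ B := by
  classical
  unfold monoVars
  rw [Finset.mem_union, Finset.mem_image, Finset.mem_image]
  constructor
  · rintro (⟨a, _, he⟩ | ⟨c', hc', he⟩)
    · exfalso
      have := congrArg Fin.val he
      simp at this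
      omega
    · rwa [← Fin.natAdd_injective _ _ he]
  · intro hc; exact Or.inr ⟨c, hc, rfl⟩

/-- **The alternating interleaving** `x_{σ 0} y_{τ 0} x_{σ 1} y_{τ 1} …`: step `2k` reads `x_{σ k}`, step `2k+1` reads `y_{τ k}`. -/
theorem exists_interleaving (h : ℕ) (σ τ : Equiv.Perm (Fin h)) :
    ∃ π : Equiv.Perm (Fin (h + h)), ∀ k : Fin h,
      π ⟨2 * k, by omega⟩ = Fin.castAdd h (σ k) ∧ π ⟨2 * k + 1, by omega⟩ = Fin.natAdd h (τ k) := by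
  let f : Fin (h + h) → Fin (h + h) := fun t =>
    if t.val % 2 = 0 then Fin.castAdd h (σ ⟨t.val / 2, by omega⟩)
    else Fin.natAdd h (τ ⟨t.val / 2, by omega⟩)
  have hf : Function.Injective f := by
    intro t t' htt
    simp only [f] at htt
    split_ifs at htt with h1 h2 h2
    · have := Fin.ext_iff.1 (σ.injective (Fin.castAdd_injective _ _ htt))
      simp only at this
      exact Fin.ext (by omega)
    · exfalso; have := congrArg Fin.val htt; simp at this; omega
    · exfalso; have := congrArg Fin.val htt; simp at this; omega
    · have := Fin.ext_iff.1 (τ.injective (Fin.natAdd_injective _ _ htt))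
      simp only at this
      exact Fin.ext (by omega)
  refine ⟨Equiv.ofBijective f (Finite.injective_iff_bijective.1 hf), fun k => ⟨?_, ?_⟩⟩
  · rw [Equiv.ofBijective_apply]
    simp only [f, Nat.mul_mod_right, ↓reduceIte]
    congr 2; exact Fin.ext (by simp)
  · rw [Equiv.ofBijective_apply]
    simp only [f, Nat.mul_add_mod_self_left, Nat.one_mod, one_ne_zero, ↓reduceIte]
    congr 2; exact Fin.ext (show (2 * (k : ℕ) + 1) / 2 = k by omega)


/-- `decide P = c` read as an iff. -/
theorem decide_eq_iff_iff (P : Prop) [Decidable P] (c : Bool) : decide P = c ↔ (P ↔ c = true) := by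
  cases c <;> simp

/-- **Run analysis of a sequential-transducer automaton** on the alternating interleaving (`x_{σ k}` at step `2k`,
`y_{τ k}` at step `2k+1`). The automaton (states `enc q o`: transducer state `q`, pending output bit `o`) moves
`enc q o → enc (δ k q a) (out k q a)` on the `x`-step reading `a = [σ k ∈ A]`, and on the `y`-step survives iff the bit
`[τ k ∈ B]` equals the pending output bit. Hence a run with all weights nonzero exists on the word of `(A, B)` iff
`B` is the transducer image of `A`: `∀ k, [τ k ∈ B] = out k (q_A k) [σ k ∈ A]` (`q_A` the state trajectory of `A`). -/
theorem transducer_run_iff {Q : Type*} {h m : ℕ} (σ τ : Equiv.Perm (Fin h)) (π : Equiv.Perm (Fin (h + h)))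
    (hπx : ∀ (t : Fin (h + h)) (k : Fin h), (t : ℕ) = 2 * k → π t = Fin.castAdd h (σ k))
    (hπy : ∀ (t : Fin (h + h)) (k : Fin h), (t : ℕ) = 2 * k + 1 → π t = Fin.natAdd h (τ k))
    (δ : Fin h → Q → Bool → Q) (out : Fin h → Q → Bool → Bool) (q₀ : Q)
    (enc : Q → Bool → Fin m) (henc : ∀ q o q' o', enc q o = enc q' o' → q = q' ∧ o = o')
    (T : Fin (h + h) → Bool → Matrix (Fin m) (Fin m) ℕ) (l rr : Fin m → ℕ)
    (hTx : ∀ (t : Fin (h + h)) (k : Fin h), (t : ℕ) = 2 * k → ∀ (b : Bool) (v v' : Fin m),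
      (T t b v v' ≠ 0 ↔ ∃ q o, v = enc q o ∧ v' = enc (δ k q b) (out k q b)))
    (hTy : ∀ (t : Fin (h + h)) (k : Fin h), (t : ℕ) = 2 * k + 1 → ∀ (b : Bool) (v v' : Fin m),
      (T t b v v' ≠ 0 ↔ ∃ q, v = enc q b ∧ v' = v))
    (hl : ∀ v, l v ≠ 0 ↔ v = enc q₀ false) (hrr : ∀ v, rr v ≠ 0)
    (A B : Finset (Fin h)) (q : Fin (h + 1) → Q) (hq0 : q 0 = q₀)
    (hqs : ∀ k : Fin h, q k.succ = δ k (q k.castSucc) (decide (σ k ∈ A))) :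
    (∃ p : Fin (h + h + 1) → Fin m, l (p 0) ≠ 0 ∧
        (∀ t : Fin (h + h), T t (decide (π t ∈ monoVars h A B)) (p t.castSucc) (p t.succ) ≠ 0) ∧
        rr (p (Fin.last (h + h))) ≠ 0) ↔
      ∀ k : Fin h, (τ k ∈ B ↔ out k (q k.castSucc) (decide (σ k ∈ A)) = true) := by
  -- the bits read at the two steps of round `k`
  have hbx : ∀ (t : Fin (h + h)) (k : Fin h), (t : ℕ) = 2 * k →
      decide (π t ∈ monoVars h A B) = decide (σ k ∈ A) := by
    intro t k ht; rw [hπx t k ht]; simp only [castAdd_mem_monoVars]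
  have hby : ∀ (t : Fin (h + h)) (k : Fin h), (t : ℕ) = 2 * k + 1 →
      decide (π t ∈ monoVars h A B) = decide (τ k ∈ B) := by
    intro t k ht; rw [hπy t k ht]; simp only [natAdd_mem_monoVars]
  -- the pending output bit of round `k`
  set c : Fin h → Bool := fun k => out k (q k.castSucc) (decide (σ k ∈ A)) with hc
  constructor
  · rintro ⟨p, hp0, hpT, -⟩
    -- induction over rounds: at position `2n` the automaton is in transducer state `q n`, and all earlier bits match
    have key : ∀ n (hn : n ≤ h), (∃ o, ∀ i : Fin (h + h + 1), (i : ℕ) = 2 * n → p i = enc (q ⟨n, by omega⟩) o) ∧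
        ∀ k : Fin h, (k : ℕ) < n → (τ k ∈ B ↔ c k = true) := by
      intro n
      induction n with
      | zero =>
        intro _
        refine ⟨⟨false, fun i hi => ?_⟩, fun k hk => absurd hk (Nat.not_lt_zero _)⟩
        have hi0 : i = 0 := Fin.ext (by simpa using hi)
        rw [hi0, (hl _).1 hp0, ← hq0]
        rfl
      | succ n ih =>
        intro hn
        obtain ⟨⟨o, ho⟩, hbits⟩ := ih (by omega)
        let k : Fin h := ⟨n, by omega⟩
        let tx : Fin (h + h) := ⟨2 * n, by omega⟩
        let ty : Fin (h + h) := ⟨2 * n + 1, by omega⟩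
        -- the x-step of round n
        have hx := hpT tx
        rw [hbx tx k rfl, hTx tx k rfl] at hx
        obtain ⟨q', o', h1, h2⟩ := hx
        have hcs : p tx.castSucc = enc (q ⟨n, by omega⟩) o := ho _ (by simp [tx])
        rw [hcs] at h1
        obtain ⟨hqq, -⟩ := henc _ _ _ _ h1
        have hkc : (k.castSucc : Fin (h + 1)) = ⟨n, by omega⟩ := Fin.ext (by simp [k])
        have hks : (k.succ : Fin (h + 1)) = ⟨n + 1, by omega⟩ := Fin.ext (by simp [k])
        have h2' : p tx.succ = enc (q ⟨n + 1, by omega⟩) (c k) := by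
          rw [h2, ← hqq, ← hks, hqs k, hkc]
          rfl
        -- the y-step of round n
        have hy := hpT ty
        rw [hby ty k rfl, hTy ty k rfl] at hy
        obtain ⟨q'', h3, h4⟩ := hy
        have hsc : ty.castSucc = tx.succ := Fin.ext (by simp [tx, ty])
        rw [hsc, h2'] at h3
        obtain ⟨-, hob⟩ := henc _ _ _ _ h3
        refine ⟨⟨c k, fun i hi => ?_⟩, fun k' hk' => ?_⟩
        · have hi' : i = ty.succ := Fin.ext (by simp [ty]; omega)
          rw [hi', h4, hsc, h2']
        · rcases Nat.lt_succ_iff_lt_or_eq.1 hk' with hlt | heq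
          · exact hbits k' hlt
          · have hkk : k' = k := Fin.ext heq
            rw [hkk, ← decide_eq_iff_iff, ← hob]
    intro k
    exact (key h le_rfl).2 k k.is_lt
  · intro hB
    classical
    -- the run: position 0 ↦ enc q₀ false; positions 2n+1, 2n+2 ↦ enc (q (n+1)) (c n)
    refine ⟨fun i => if hi : (i : ℕ) = 0 then enc q₀ false else
      enc (q ⟨((i : ℕ) + 1) / 2, by omega⟩)
        (c ⟨((i : ℕ) - 1) / 2, by omega⟩), ?_, fun t => ?_, hrr _⟩
    · simp only [Fin.val_zero, ↓reduceDIte]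
      exact (hl _).2 rfl
    · -- values of the run around round n
      have hval1 : ∀ (i : Fin (h + h + 1)) (n : ℕ) (hn : n < h), (i : ℕ) = 2 * n + 1 →
          (fun i : Fin (h + h + 1) => if hi : (i : ℕ) = 0 then enc q₀ false else
            enc (q ⟨((i : ℕ) + 1) / 2, by omega⟩) (c ⟨((i : ℕ) - 1) / 2, by omega⟩)) i =
            enc (q ⟨n + 1, by omega⟩) (c ⟨n, hn⟩) := by
        intro i n hn hi
        simp only [dif_neg (show (i : ℕ) ≠ 0 by omega)]
        have e1 : (⟨((i : ℕ) + 1) / 2, by omega⟩ : Fin (h + 1)) = ⟨n + 1, by omega⟩ := Fin.ext (by simp; omega)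
        have e2 : (⟨((i : ℕ) - 1) / 2, by omega⟩ : Fin h) = ⟨n, hn⟩ := Fin.ext (by simp; omega)
        rw [e1, e2]
      have hval2 : ∀ (i : Fin (h + h + 1)) (n : ℕ) (hn : n < h), (i : ℕ) = 2 * n + 2 →
          (fun i : Fin (h + h + 1) => if hi : (i : ℕ) = 0 then enc q₀ false else
            enc (q ⟨((i : ℕ) + 1) / 2, by omega⟩) (c ⟨((i : ℕ) - 1) / 2, by omega⟩)) i =
            enc (q ⟨n + 1, by omega⟩) (c ⟨n, hn⟩) := by
        intro i n hn hi
        simp only [dif_neg (show (i : ℕ) ≠ 0 by omega)]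
        have e1 : (⟨((i : ℕ) + 1) / 2, by omega⟩ : Fin (h + 1)) = ⟨n + 1, by omega⟩ := Fin.ext (by simp; omega)
        have e2 : (⟨((i : ℕ) - 1) / 2, by omega⟩ : Fin h) = ⟨n, hn⟩ := Fin.ext (by simp; omega)
        rw [e1, e2]
      have hval0 : ∀ (i : Fin (h + h + 1)) (n : ℕ) (hn : n < h), (i : ℕ) = 2 * n → ∃ o,
          (fun i : Fin (h + h + 1) => if hi : (i : ℕ) = 0 then enc q₀ false else
            enc (q ⟨((i : ℕ) + 1) / 2, by omega⟩) (c ⟨((i : ℕ) - 1) / 2, by omega⟩)) i =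
            enc (q ⟨n, by omega⟩) o := by
        intro i n hn hi
        rcases Nat.eq_zero_or_pos n with rfl | hpos
        · refine ⟨false, ?_⟩
          simp only [dif_pos (show (i : ℕ) = 0 by omega), ← hq0]
          rfl
        · obtain ⟨n', rfl⟩ : ∃ n', n = n' + 1 := ⟨n - 1, by omega⟩
          exact ⟨c ⟨n', by omega⟩, hval2 i n' (by omega) (by omega)⟩
      -- parity of the step
      obtain ⟨n, hn2 | hn2⟩ := Nat.even_or_odd' (t : ℕ)
      · -- x-step of round n
        have hn : n < h := by omega
        let k : Fin h := ⟨n, hn⟩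
        rw [hbx t k hn2, hTx t k hn2]
        obtain ⟨o, ho⟩ := hval0 t.castSucc n hn (by simp [hn2])
        refine ⟨q ⟨n, by omega⟩, o, ho, ?_⟩
        rw [hval1 t.succ n hn (by simp [hn2])]
        have hkc : (k.castSucc : Fin (h + 1)) = ⟨n, by omega⟩ := Fin.ext (by simp [k])
        have hks : (k.succ : Fin (h + 1)) = ⟨n + 1, by omega⟩ := Fin.ext (by simp [k])
        rw [← hks, hqs k, hkc]
        rfl
      · -- y-step of round n
        have hn : n < h := by omega
        let k : Fin h := ⟨n, hn⟩
        rw [hby t k hn2, hTy t k hn2]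
        refine ⟨q ⟨n + 1, by omega⟩, ?_, ?_⟩
        · rw [hval1 t.castSucc n hn (by simp [hn2]), (decide_eq_iff_iff _ _).2 (hB k)]
        · rw [hval1 t.castSucc n hn (by simp [hn2]), hval2 t.succ n hn (by simp [hn2])]


/-- **SEQUENTIAL-TRANSDUCER LAYOUTS ARE HIT BY THE ROABP DOOR** (`--supports 19717`; memo MEMO-ttdoor-g16 §§10–11b
«transducer layouts»). Data: a deterministic finite-state transducer — states `Q` embedded in `Fin s` by `ι`, initial state
`q₀`, step-dependent transition `δ k` and output `out k`, reading the `x`-coordinates in the order `σ` and writing the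
`y`-coordinate `τ k` at round `k` — and its state trajectories `q i` on the rows `u i`. HYPOTHESIS: the columns are the
transducer images of the rows up to a row bijection `ψ`: `[τ k ∈ w j] = out k (q (ψ j) k) [σ k ∈ u (ψ j)]`, and `w` is
injective. CONCLUSION: the layout `(u, w)` — of ANY size `r ≤ 2^h` — is hit inside `SmallCircuits ℂ (2h) (3c+3)` as soon as
`2s ≤ (2h)^c` and `h ≥ 2`: the width-`2s` automaton «state × pending output bit» on the interleaving `x_{σ0} y_{τ0} x_{σ1} y_{τ1} …`
has the permutation matrix of `ψ` as its run-count matrix on `U × W` (`transducer_run_iff` + `partitionMinor_hit_of_nfaPattern`). -/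
theorem partitionMinor_hit_of_transducer {Q : Type*} (h s c : ℕ) (hs : s + s ≤ (h + h) ^ c) (hh : 4 ≤ h + h)
    (ι : Q → Fin s) (hι : Function.Injective ι)
    (σ τ : Equiv.Perm (Fin h)) (δ : Fin h → Q → Bool → Q) (out : Fin h → Q → Bool → Bool) (q₀ : Q)
    {r : ℕ} (u w : Fin r → Finset (Fin h)) (hw : Function.Injective w) (ψ : Equiv.Perm (Fin r))
    (q : Fin r → Fin (h + 1) → Q) (hq0 : ∀ i, q i 0 = q₀)
    (hqs : ∀ i (k : Fin h), q i k.succ = δ k (q i k.castSucc) (decide (σ k ∈ u i)))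
    (hwΦ : ∀ j (k : Fin h), τ k ∈ w j ↔ out k (q (ψ j) k.castSucc) (decide (σ k ∈ u (ψ j))) = true) :
    ∃ f ∈ Literature.Barriers.ValiantsHypothesis.SmallCircuits ℂ (h + h) (3 * c + 3),
      (Matrix.of fun i j : Fin r => MvPolynomial.coeff
        (∑ a ∈ u i, Finsupp.single (Fin.castAdd h a) 1 + ∑ c ∈ w j, Finsupp.single (Fin.natAdd h c) 1) f).det ≠ 0 := by
  classical
  obtain ⟨π, hπ⟩ := exists_interleaving h σ τ
  have hπx : ∀ (t : Fin (h + h)) (k : Fin h), (t : ℕ) = 2 * k → π t = Fin.castAdd h (σ k) := by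
    intro t k ht
    rw [show t = ⟨2 * k, by omega⟩ from Fin.ext ht]
    exact (hπ k).1
  have hπy : ∀ (t : Fin (h + h)) (k : Fin h), (t : ℕ) = 2 * k + 1 → π t = Fin.natAdd h (τ k) := by
    intro t k ht
    rw [show t = ⟨2 * k + 1, by omega⟩ from Fin.ext ht]
    exact (hπ k).2
  -- state encoding: (q, o) ↦ inl (ι q) / inr (ι q)
  let enc : Q → Bool → Fin (s + s) := fun q o =>
    finSumFinEquiv (if o then Sum.inr (ι q) else Sum.inl (ι q))
  have henc : ∀ q o q' o', enc q o = enc q' o' → q = q' ∧ o = o' := by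
    intro q o q' o' he
    have he' := finSumFinEquiv.injective he
    cases o <;> cases o' <;>
      simp only [if_true, if_false, Sum.inl.injEq, Sum.inr.injEq, reduceCtorEq, Bool.false_eq_true] at he' <;>
      exact ⟨hι he', rfl⟩
  -- the automaton tables
  let T : Fin (h + h) → Bool → Matrix (Fin (s + s)) (Fin (s + s)) ℕ := fun t b => Matrix.of fun v v' =>
    if (t : ℕ) % 2 = 0 then
      (if ∃ q' o, v = enc q' o ∧ v' = enc (δ ⟨(t : ℕ) / 2, by omega⟩ q' b) (out ⟨(t : ℕ) / 2, by omega⟩ q' b)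
        then 1 else 0)
    else (if ∃ q', v = enc q' b ∧ v' = v then 1 else 0)
  let l : Fin (s + s) → ℕ := fun v => if v = enc q₀ false then 1 else 0
  let rr : Fin (s + s) → ℕ := fun _ => 1
  have hTx : ∀ (t : Fin (h + h)) (k : Fin h), (t : ℕ) = 2 * k → ∀ (b : Bool) (v v' : Fin (s + s)),
      (T t b v v' ≠ 0 ↔ ∃ q' o, v = enc q' o ∧ v' = enc (δ k q' b) (out k q' b)) := by
    intro t k ht b v v'
    have hk : (⟨(t : ℕ) / 2, by omega⟩ : Fin h) = k := Fin.ext (by simp only [ht]; omega)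
    simp only [T, Matrix.of_apply, show (t : ℕ) % 2 = 0 by omega, if_true, hk]
    simp
  have hTy : ∀ (t : Fin (h + h)) (k : Fin h), (t : ℕ) = 2 * k + 1 → ∀ (b : Bool) (v v' : Fin (s + s)),
      (T t b v v' ≠ 0 ↔ ∃ q', v = enc q' b ∧ v' = v) := by
    intro t k ht b v v'
    simp only [T, Matrix.of_apply, show ¬ ((t : ℕ) % 2 = 0) by omega, if_false]
    simp
  have hl : ∀ v, l v ≠ 0 ↔ v = enc q₀ false := by intro v; simp [l]
  have hrr : ∀ v, rr v ≠ 0 := by intro v; simp [rr]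
  refine partitionMinor_hit_of_nfaPattern h (s + s) c hs hh u w π T l rr 1 ψ.symm ?_ ?_
  · -- ACCEPT the diagonal words: `w (ψ⁻¹ i)` is the transducer image of `u i`
    intro i
    refine (transducer_run_iff σ τ π hπx hπy δ out q₀ enc henc T l rr hTx hTy hl hrr
      (u i) (w (ψ.symm i)) (q i) (hq0 i) (hqs i)).2 fun k => ?_
    have := hwΦ (ψ.symm i) k
    rwa [Equiv.apply_symm_apply] at this
  · -- REJECT below (in fact off) the diagonal: an accepting run forces `w (ψ⁻¹ j) = Φ(u i) = w (ψ⁻¹ i)`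
    intro i j hij p
    by_contra hcon
    push Not at hcon
    obtain ⟨h0, hT, hN⟩ := hcon
    have hrun := (transducer_run_iff σ τ π hπx hπy δ out q₀ enc henc T l rr hTx hTy hl hrr
      (u i) (w (ψ.symm j)) (q i) (hq0 i) (hqs i)).1 ⟨p, h0, hT, hN⟩
    have heq : w (ψ.symm j) = w (ψ.symm i) := by
      ext x
      obtain ⟨k, rfl⟩ := τ.surjective x
      have hi := hwΦ (ψ.symm i) k
      rw [Equiv.apply_symm_apply] at hi
      rw [hrun k, hi]
    exact absurd (ψ.symm.injective (hw heq)) (ne_of_lt hij)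

end Summit.ValiantsHypothesis.Theorems.BarrierLever.RoabpDoor
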